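import Literature.AnabelianGeometry.EtaleTheta.TemperedFrobenioidOfGaloisCoveringRankOnePoint
import Literature.AnabelianGeometry.EtaleTheta.Discharge.Sec3Thm37ivGenuineBase
import Literature.AnabelianGeometry.EtaleTheta.Discharge.Sec3BLambdaInjectiveOfRlfRWeakReflects
import Literature.AnabelianGeometry.EtaleTheta.Discharge.Sec3BLambdaInjectiveOfRlf
import Literature.AlgebraicGeometry.Frobenioids.BiratUnitsPush
import Literature.AlgebraicGeometry.Frobenioids.PadicFrobenioidZeroMonoid
import Literature.AlgebraicGeometry.Frobenioids.MonoidsTorsionFreeCharInjective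
import Literature.AlgebraicGeometry.Frobenioids.DirectSumPrimes
import HarnessLib

/-!
# [EtTh] Def. 3.6 (ii): a tempered Frobenioid of monoid type `ℤ` over ANY weak Def. 3.6 (i) data `ofRlfZWeak dm hpf`, along
# ANY base functor `D ⥤ D₀` whose values are RANK-ONE points — generic NV engine (class (b))

S. Mochizuki, *The étale theta function …*, Publ. RIMS **45** (2009) [MochizukiEtTh2009], Def. 3.6 (ii) p.76–77
[cite: MochizukiEtTh2009, Def 3.6 p.77]; [FrdI] Def. 1.1 (i)(ii) p.19, Thm. 5.2 (ii) p.100.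

abc-iut cell, block C / W6, seat abc-iut-w6-d048 (gen 3), L2-lead R398.  This seat's `TemperedFrobenioid.ofRankOnePoint`
(`TemperedFrobenioidOfGaloisCoveringRankOnePoint.lean`) built the Def. 3.6 (ii) data over the ONE-OBJECT base `{∗} ↦ S₀`; the
§4 interface `BiKummerSetting.Thm44Hyp.baseShape` ("`D = D₀[𝒟]`": base functor fully faithful) excludes constant base functors
(kernel finding F-w6d048g3-2).  This file is the same construction along an ARBITRARY base functor `F : D ⥤ D₀` (any connected,
totally epimorphic `D` of FSM-type) over ARBITRARY Def. 3.3 (iii) data `dm` whose `Φ₀`'s are rank one along `F`: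
* `TemperedFrobenioid.RankOneBase dm D` — the data: `F`, `e_A : Φ₀(F A) ≃* ℕ`, "every effective log-divisor over `F A` is the
  divisor of a constant function" (`hcnst`), and the pull-backs of `Φ₀` along `F`-images injective and divisibility-reflecting;
* `RankOneBase.Φsub` — `Φ(A) := im(Φ₀(F A)^pf → Φ₀(F A)^rlf)` as a subfunctor in monoids of `Φ^{ℝ-log} = Φ₀^ℝ|_D`;
* **`TemperedFrobenioid.ofRankOneBase P hpf hD hD' hFSM R S : TemperedFrobenioid (ofRlfZWeak dm hpf) D (treeCatVocab D R S)`** with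
  `base := P.F` — EVERY Def. 3.6 (ii) condition PROVED: `Φ(A)` group-saturated, weakly perf-factorial with cofinal perfection,
  divisorial, a monoid on `D` (pull-backs injective into sharp monoids ⇒ characteristically injective; FSM-morphisms are
  isomorphisms in a category of FSM-type ⇒ bijective pull-backs), (a) `Φ^{bs-fld} = Φ` monoprime, (b) `F(A) → (Φ^{bs-fld})^gp(A)`
  nonzero;
* THEOREMS for the §4 consumers: `ofRankOneBase_isPerfect` (`hP`), `ofRankOneBase_Φ_pull_apply_of_trivial` /
  `isNonDilating_ofRankOneBase_of_trivial` ("`Φ` non-dilating" along endomorphisms pulling `Φ₀` back identically — [FrdI]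
  Def. 1.1 (i)), `isFrobenioid_ofRankOneBase` ([FrdI] Thm. 5.2 (ii) via abc-iut-L2-t3's `isFrobenioid_of_isOfFSMType`).
HONEST FRAMING: class (b) construction over interface records; no named Prop fact, no instance, no sorry; nothing here bears on
[IUTchIII] Cor. 3.12; typed ≠ proved.
-/

namespace Literature.AnabelianGeometry.EtaleTheta

open CategoryTheory Opposite Function Literature.AlgebraicGeometry.Frobenioids

universe u₀ v₀ w u v

namespace TemperedFrobenioid

/-- **Rank-one base data** for Def. 3.3 (iii) data `dm` over `D₀` and a base category `D`: a functor `F : D ⥤ D₀` such that every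
`Φ₀(F A) ≅ ℤ_{≥0}` (`e`), every effective log-divisor over `F A` is the log-divisor of a CONSTANT log-meromorphic function
(`hcnst`: "`Φ₀^cnst = Φ₀`"), and the pull-backs of `Φ₀` along `F`-images are injective and reflect divisibility.
[cite: MochizukiEtTh2009, Def 3.6 p.77] -/
structure RankOneBase {D₀ : Type u₀} [Category.{v₀} D₀] (dm : DivisorMonoids.{u₀, v₀, w} D₀)
    (D : Type u) [Category.{v} D] : Type (max u₀ v₀ w u v) where
  /-- the base functor `D → D₀` -/
  F : D ⥤ D₀
  /-- `Φ₀(F A) ≅ ℤ_{≥0}` -/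
  e : ∀ A : D, dm.Φ₀.obj (op (F.obj A)) ≃* Multiplicative ℕ
  /-- every effective log-divisor over `F A` is the log-divisor of a constant function -/
  hcnst : ∀ (A : D) (m : dm.Φ₀.obj (op (F.obj A))),
    ∃ b ∈ dm.F₀ (op (F.obj A)), dm.div₀ _ b = Algebra.GrothendieckGroup.of m
  /-- pull-backs of `Φ₀` along `F`-images are injective -/
  hΦinj : ∀ {A B : D} (f : A ⟶ B), Injective (dm.Φ₀.map (F.map f).op).hom
  /-- pull-backs of `Φ₀` along `F`-images reflect divisibility -/
  hΦrefl : ∀ {A B : D} (f : A ⟶ B) (a b : dm.Φ₀.obj (op (F.obj B))),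
    (dm.Φ₀.map (F.map f).op).hom a ∣ (dm.Φ₀.map (F.map f).op).hom b → a ∣ b

namespace RankOneBase

variable {D₀ : Type u₀} [Category.{v₀} D₀] {dm : DivisorMonoids.{u₀, v₀, w} D₀}
  (hpf : ∀ Y : D₀ᵒᵖ, IsPerfFactorialCof (dm.Φ₀.obj Y)) {D : Type u} [Category.{v} D] (P : RankOneBase dm D)

/-- `Φ₀(F A)` is monoprime (`≅ ℤ_{≥0}`). [cite: MochizukiEtTh2009, Rmk 3.3.1 p.73] -/
theorem isMonoprime_Φ₀ (A : D) : IsMonoprime (dm.Φ₀.obj (op (P.F.obj A))) :=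
  IsMonoprime.of_mulEquiv_univ (P.e A).symm isMonoprime_multiplicative_nat

/-- `Φ(A) := im(Φ₀(F A)^pf → Φ₀(F A)^rlf)` (weak realification map). [cite: MochizukiEtTh2009, Def 3.6 p.76] -/
noncomputable def pfImage (A : Dᵒᵖ) : Submonoid ((RealifiedDivisorMonoids.ofRlfZWeak dm hpf).ΦR.obj (op (P.F.obj A.unop))) :=
  MonoidHom.mrange (hpf (op (P.F.obj A.unop))).weak.toRealification

/-- Every element of `Φ(A)` is base-field-theoretic: its class lies in `ℝ·Φ₀^cnst(F A)` (by `hcnst` and root-closure).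
[cite: MochizukiEtTh2009, Def 3.6 p.77] -/
theorem of_mem_cnstR_of_mem_pfImage (A : Dᵒᵖ) {x : (RealifiedDivisorMonoids.ofRlfZWeak dm hpf).ΦR.obj (op (P.F.obj A.unop))}
    (hx : x ∈ P.pfImage hpf A) :
    Algebra.GrothendieckGroup.of x ∈ (RealifiedDivisorMonoids.ofRlfZWeak dm hpf).cnstR (op (P.F.obj A.unop)) := by
  obtain ⟨a, rfl⟩ := hx
  obtain ⟨⟨m, n⟩, rfl⟩ := Perfection.mk_surjective a
  apply (RealifiedDivisorMonoids.ofRlfZWeak dm hpf).mem_cnstR_of_pow_mem _ n.ne_zero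
  rw [← map_pow, ← map_pow, Perfection.mk_pow_self]
  obtain ⟨b, hb, hbm⟩ := P.hcnst A.unop m
  have key : EtaleTheta.gpMap ((RealifiedDivisorMonoids.ofRlfZWeak dm hpf).toR (op (P.F.obj A.unop)))
      (dm.div₀ (op (P.F.obj A.unop)) b) ∈ (RealifiedDivisorMonoids.ofRlfZWeak dm hpf).cnstR (op (P.F.obj A.unop)) :=
    (RealifiedDivisorMonoids.ofRlfZWeak dm hpf).cnst_le_cnstR (op (P.F.obj A.unop)) b hb
  have h : EtaleTheta.gpMap ((RealifiedDivisorMonoids.ofRlfZWeak dm hpf).toR (op (P.F.obj A.unop)))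
      (dm.div₀ (op (P.F.obj A.unop)) b) =
      Algebra.GrothendieckGroup.of ((hpf (op (P.F.obj A.unop))).weak.toRealification (Perfection.of _ m)) := by
    rw [hbm]
    exact EtaleTheta.gpMap_of _ _
  exact (congrArg (· ∈ (RealifiedDivisorMonoids.ofRlfZWeak dm hpf).cnstR (op (P.F.obj A.unop))) h).mp key

/-- `Φ(A) ∩ ℝ·Φ₀^cnst = Φ(A)` ("`Φ^{bs-fld} = Φ`"). [cite: MochizukiEtTh2009, Def 3.6 p.77] -/
theorem pfImage_inf_cnstR_eq (A : Dᵒᵖ) :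
    P.pfImage hpf A ⊓ ((RealifiedDivisorMonoids.ofRlfZWeak dm hpf).cnstR (op (P.F.obj A.unop))).toSubmonoid.comap
      Algebra.GrothendieckGroup.of = P.pfImage hpf A :=
  inf_eq_left.mpr fun _ hx => P.of_mem_cnstR_of_mem_pfImage hpf A hx

/-- `Φ(A)` is monoprime (`≅ ℚ_{≥0}`). [cite: MochizukiEtTh2009, Def 3.6 p.77] -/
theorem isMonoprime_pfImage (A : Dᵒᵖ) : IsMonoprime ↥(P.pfImage hpf A) :=
  Example39NV.isMonoprime_mrange_toRealification (P.isMonoprime_Φ₀ A.unop)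

/-- `Φ(A)` is perfect (the image of a perfection). [cite: MochizukiEtTh2009, Def 4.1 p.86] -/
theorem isPerfect_pfImage (A : Dᵒᵖ) : IsPerfect ↥(P.pfImage hpf A) :=
  Example39NV.isPerfect_mrange_toRealification (MonoprimeStructure.isPerfFactorial (P.isMonoprime_Φ₀ A.unop))

/-- The generator `ι(e⁻¹ 1) ∈ Φ(A)` is not `1`. [cite: MochizukiEtTh2009, Def 3.6 p.77] -/
theorem toRealification_gen_ne_one (A : D) :
    (hpf (op (P.F.obj A))).weak.toRealification (Perfection.of _ ((P.e A).symm (Multiplicative.ofAdd 1))) ≠ 1 := by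
  intro h
  have h1 := PfImageWeak.toRealification_injective (hpf (op (P.F.obj A))).weak (h.trans (map_one _).symm)
  have h2 : (P.e A).symm (Multiplicative.ofAdd 1) = 1 :=
    (Perfection.mk_eq_one_iff_of_isSharp (MonoprimeStructure.isSharp (P.isMonoprime_Φ₀ A))).mp h1
  have h3 : (Multiplicative.ofAdd (1 : ℕ) : Multiplicative ℕ) = 1 := by
    rw [← (P.e A).apply_symm_apply (Multiplicative.ofAdd 1), h2, map_one]
  exact one_ne_zero (ofAdd_eq_one.mp h3)

/-- **`Φ ⊆ Φ^{ℝ-log} := Φ₀^ℝ|_D` as a subfunctor in monoids along `F`.** [cite: MochizukiEtTh2009, Def 3.6 p.76] -/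
noncomputable def Φsub : SubMonoidOn (P.F.op ⋙ (RealifiedDivisorMonoids.ofRlfZWeak dm hpf).ΦR) where
  carrier A := P.pfImage hpf A
  map_mem := by
    rintro A B f _ ⟨a, rfl⟩
    exact ⟨Literature.AlgebraicGeometry.Frobenioids.Perfection.map (dm.Φ₀.map (P.F.map f.unop).op).hom a,
      (DFunLike.congr_fun (rlfMapWeak_comp_toRealification dm.Φ₀ hpf (P.F.map f.unop).op) a).symm⟩

/-- The carrier of `Φsub` at `A` is `Φ(A)`. [cite: MochizukiEtTh2009, Def 3.6 p.76] -/
@[simp] theorem Φsub_carrier (A : Dᵒᵖ) : (P.Φsub hpf).carrier A = P.pfImage hpf A := rfl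

/-- **The pull-backs of `Φ` are injective** (`Φ₀(F f)^rlf` is injective for injective, divisibility-reflecting `Φ₀(F f)` —
this seat's `rlfMapWeak_injective_of_reflects`). [cite: MochizukiFrdI2008, Def. 1.1 (ii) p.19] -/
theorem Φsub_pull_injective {A B : Dᵒᵖ} (f : A ⟶ B) : Injective ((P.Φsub hpf).pull f) := by
  intro x y h
  apply Subtype.ext
  have h' := congrArg Subtype.val h
  exact rlfMapWeak_injective_of_reflects dm.Φ₀ hpf (P.F.map f.unop).op (P.hΦinj f.unop) (P.hΦrefl f.unop) h'

/-- **The pull-back of `Φ` along an endomorphism `φ` pulling `Φ₀(F A)` back IDENTICALLY is the identity** (e.g. every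
endomorphism of a connected covering under a trivial Galois action). [cite: MochizukiFrdI2008, Def. 1.1 (i) p.19] -/
theorem Φsub_pull_apply_of_trivial {A : Dᵒᵖ} (φ : A ⟶ A)
    (hid : ∀ m : dm.Φ₀.obj (op (P.F.obj A.unop)), (dm.Φ₀.map (P.F.map φ.unop).op).hom m = m)
    (x : (P.Φsub hpf).carrier A) : (P.Φsub hpf).pull φ x = x := by
  apply Subtype.ext
  obtain ⟨a, ha⟩ := x.2
  obtain ⟨⟨m, n⟩, rfl⟩ := Perfection.mk_surjective a
  rw [SubMonoidOn.coe_pull]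
  change rlfMapWeak dm.Φ₀ hpf (P.F.map φ.unop).op x.1 = x.1
  rw [← ha]
  have h := DFunLike.congr_fun (rlfMapWeak_comp_toRealification dm.Φ₀ hpf (P.F.map φ.unop).op) (Perfection.mk m n)
  rw [MonoidHom.comp_apply, MonoidHom.comp_apply, Literature.AlgebraicGeometry.Frobenioids.Perfection.map_mk, hid] at h
  exact h

end RankOneBase

/-- An endomorphism of a monoid that is pointwise the identity is non-dilating ([FrdI] Def. 1.1 (i): its characteristic IS
the identity). [cite: MochizukiFrdI2008, Def. 1.1 (i) p.19] -/
theorem isNonDilating_of_apply_eq {M : Type w} [CommMonoid M] (α : M →* M) (h : ∀ x, α x = x) : IsNonDilating α := by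
  intro _
  rw [show α = MonoidHom.id M from MonoidHom.ext h]
  exact MonoidHom.ext associatesMap_id_apply

section Engine

variable {D₀ : Type u₀} [Category.{v₀} D₀] {dm : DivisorMonoids.{u₀, v₀, w} D₀}
  (hpf : ∀ Y : D₀ᵒᵖ, IsPerfFactorialCof (dm.Φ₀.obj Y)) {D : Type u} [Category.{v} D] (P : RankOneBase dm D)
  (hD : IsConnected D) (hD' : IsTotallyEpimorphic D) (hFSM : IsOfFSMType D) (R S : (Dᵒᵖ ⥤ CommMonCat.{w}) → Prop)

include hFSM in
/-- **Def. 3.6 (ii) data of monoid type `ℤ` over the weak Def. 3.6 (i) data `ofRlfZWeak dm hpf`, ALONG THE BASE FUNCTOR `P.F`**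
(`D` connected, totally epimorphic, of FSM-type): `Φ := im(Φ₀^pf → Φ₀^rlf)` objectwise along `F`; every condition PROVED.
[cite: MochizukiEtTh2009, Def 3.6 p.77] -/
noncomputable def ofRankOneBase : TemperedFrobenioid (RealifiedDivisorMonoids.ofRlfZWeak dm hpf) D (treeCatVocab D R S) where
  isConnected := hD
  isTotallyEpimorphic := hD'
  base := P.F
  Φ := P.Φsub hpf
  isGroupSaturated A := PfImageWeak.isGroupSaturated_mrange_toRealification (hpf (op (P.F.obj A.unop))).weak
  isPerfFactorial A := PfImageWeak.isPerfFactorialCof_mrange_toRealification (hpf (op (P.F.obj A.unop)))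
  isDivisorialOn := by
    rw [treeCatVocab_isDivisorialOn]
    refine ⟨⟨fun f => isCharInjective_of_injective_of_isSharp _ (P.Φsub_pull_injective hpf f.op)
      (PfImageWeak.isDivisorial_mrange_toRealification (hpf _)).isSharp, fun f hf => ?_⟩,
      fun A => PfImageWeak.isDivisorial_mrange_toRealification (hpf (op (P.F.obj A)))⟩
    exact (fun _ : IsIso f => PreFrobenioid.RatFrac.pull_bijective_of_isIso f) (hFSM.isIso_of_isFSM f hf)
  isMonoprime_bsFld A :=
    IsMonoprime.of_mulEquiv (MulEquiv.submonoidCongr (P.pfImage_inf_cnstR_eq hpf A).symm) (P.isMonoprime_pfImage hpf A)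
  exists_FΛ_div_ne A := by
    obtain ⟨b, hb, hbm⟩ := P.hcnst A.unop ((P.e A.unop).symm (Multiplicative.ofAdd 1))
    refine ⟨b, hb, (hpf (op (P.F.obj A.unop))).weak.toRealification (Perfection.of _ ((P.e A.unop).symm (Multiplicative.ofAdd 1))),
      ⟨_, rfl⟩, 1, one_mem _, P.toRealification_gen_ne_one hpf A.unop, ?_⟩
    simp only [map_one, div_one]
    rw [RealifiedDivisorMonoids.ofRlfZWeak_divΛ_apply]
    change EtaleTheta.gpMap _ (dm.div₀ (op (P.F.obj A.unop)) b) = _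
    rw [hbm]
    exact EtaleTheta.gpMap_of _ _

/-- `Φ(A)` of the engine is `im(Φ₀(F A)^pf → Φ₀(F A)^rlf)`. [cite: MochizukiEtTh2009, Def 3.6 p.77] -/
@[simp] theorem ofRankOneBase_Φ_carrier (A : Dᵒᵖ) :
    (ofRankOneBase hpf P hD hD' hFSM R S).Φ.carrier A = P.pfImage hpf A := rfl

/-- The base functor of the engine is `P.F`. [cite: MochizukiEtTh2009, Def 3.6 p.77] -/
@[simp] theorem ofRankOneBase_base : (ofRankOneBase hpf P hD hD' hFSM R S).base = P.F := rfl

/-- The monoid type of the engine is `ℤ` (the `hZ` slot of the §4 setting). [cite: MochizukiEtTh2009, Def 4.1 p.86] -/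
theorem ofRankOneBase_monoidType : (ofRankOneBase hpf P hD hD' hFSM R S).monoidType = MonoidType.Z := rfl

/-- **`Φ(A)` is perfect** (the `hP` slot of the §4 setting). [cite: MochizukiEtTh2009, Def 4.1 p.86] -/
theorem ofRankOneBase_isPerfect (A : Dᵒᵖ) : IsPerfect ((ofRankOneBase hpf P hD hD' hFSM R S).Φ.carrier A) :=
  P.isPerfect_pfImage hpf A

/-- **`Φ` is non-dilating along every endomorphism pulling `Φ₀` back identically** (the `isNonDilating` slot of `Thm44Hyp`).
[cite: MochizukiFrdI2008, Def. 1.1 (i) p.19] -/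
theorem isNonDilating_ofRankOneBase_of_trivial (A : Dᵒᵖ) (φ : A ⟶ A)
    (hid : ∀ m : dm.Φ₀.obj (op (P.F.obj A.unop)), (dm.Φ₀.map (P.F.map φ.unop).op).hom m = m) :
    treeMonoidVocabWeak.{w}.IsNonDilating ((ofRankOneBase hpf P hD hD' hFSM R S).Φ.carrier A)
      ((ofRankOneBase hpf P hD hD' hFSM R S).Φ.pull φ) :=
  isNonDilating_of_apply_eq _ (P.Φsub_pull_apply_of_trivial hpf φ hid)

/-- **The engine's tempered Frobenioid IS a Frobenioid** ([FrdI] Thm. 5.2 (ii); abc-iut-L2-t3's `isFrobenioid_of_isOfFSMType`,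
`hBinj` from the injectivity of the `B₀`-pull-backs). [cite: MochizukiFrdI2008, Thm. 5.2 (ii) p.100] -/
theorem isFrobenioid_ofRankOneBase (hB₀inj : ∀ {Y Y' : D₀ᵒᵖ} (g : Y ⟶ Y'), Injective (dm.B₀.map g).hom) :
    PreFrobenioid.IsFrobenioid (ofRankOneBase hpf P hD hD' hFSM R S).toElem :=
  (ofRankOneBase hpf P hD hD' hFSM R S).isFrobenioid_of_isOfFSMType
    (RealifiedDivisorMonoids.ofRlfZWeak_hBinj dm hpf hB₀inj) hFSM

/-- **Non-vacuity**: rank-one base data yield a tempered Frobenioid over `ofRlfZWeak dm hpf` with the GIVEN base functor.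
[cite: MochizukiEtTh2009, Def 3.6 p.77] -/
theorem nonempty_of_rankOneBase (P₀ : RankOneBase dm D) (hD₀ : IsConnected D) (hD₀' : IsTotallyEpimorphic D)
    (hFSM₀ : IsOfFSMType D) (R₀ S₀ : (Dᵒᵖ ⥤ CommMonCat.{w}) → Prop) :
    ∃ C : TemperedFrobenioid (RealifiedDivisorMonoids.ofRlfZWeak dm hpf) D (treeCatVocab D R₀ S₀), C.base = P₀.F :=
  ⟨ofRankOneBase hpf P₀ hD₀ hD₀' hFSM₀ R₀ S₀, rfl⟩

end Engine

end TemperedFrobenioid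

end Literature.AnabelianGeometry.EtaleTheta
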